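import Summits.ABC.ABC.Theorems.EisensteinQuarantine.Negative.EisensteinQuarantineFalseOfForcedPairOccurrence
import Summits.ABC.ABC.Theorems.DefiniteXiEisensteinQuarantineHeckeBoundary
import HarnessLib

/-!
# The Hecke-boundary criterion `FreyHeckeBoundaryDepth` for the research stub `stub_forcedPairOccurrence`
# (crux `EisensteinQuarantine`, stmt-ABC-15023, line `forced-pair-dlog`; ideator k3's kernel K_B)

Helper file (`--supports stmt-ABC-15023 --as helper`) written by the stub-plan prover of `stub_forcedPairOccurrence`
(STUB-PLAN-stub_forcedPairOccurrence.md §2 entry 21).  The registered stub (= `ForcedPairOccurrence`, verbatim) asks,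
at every forced pair `(q, ℓ)`, for a `w`-orthogonal `ψ` with `φ ≡ ψ (mod 2^{v₂(q−1)−c})`, i.e. (dictionary p96490)
`φ ∈ (φ^{⊥_w} ∩ M) + 2^k M` for the Brandt module `M = ℤ[Cls O]`.  Ideator k3's kernel K_B replaces the orthogonal
complement by the image of the Eisenstein-shifted Hecke ideal: `φ ∈ I_E M + 2^k M`, `I_E = (B(p) − a_p(E) : p ∤ N)` —
`FreyHeckeBoundaryDepth` below.  Since `I_E M ⊆ φ^{⊥_w}` (self-adjointness of the Brandt matrices for Gross's pairing,
`Brandt.wpair_mulVec` + Eichler's weight symmetry `Brandt.XiSetup.weight_mul_matrix_symm`, PROVED in the tree), K_B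
implies the stub (`forcedPairOccurrence_of_freyHeckeBoundaryDepth`, via `occurrence_of_heckeBoundary`); it is STRICTLY
STRONGER, the gap being the 2-torsion of the coinvariants `M / I_E M` = `(φ^{⊥_w} ∩ M) / I_E M` at the Eisenstein maximal
ideal `(2, I_E)` — the uncharted object at composite squarefree level (Wake–Wang-Erickson treat `p ≥ 5`; Yoo odd `p`).
Research statement, NOT proved, NOT in print; recorded so that a Brandt-side proof source can close the stub by name.

## References

* [Eichler1973] M. Eichler, LNM 320 (1973), Ch. II §6 (17) (weight symmetry).
* [Mazur1977] B. Mazur, Publ. Math. IHÉS 47 (1977), II.16.6, II.18.10.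
-/

-- `Summit.<Summit>.<Problem>`: for the single-conjunct summit `ABC` the duplicate `ABC.ABC` is mandated.
set_option linter.dupNamespace false

noncomputable section

namespace Summit.ABC.ABC.Theorems

open scoped BigOperators Matrix
open Literature.NumberTheory.Automorphic Literature.NumberTheory.EllipticCurves
open Summit.ABC.ABC.Theorems.EisensteinQuarantine.Negative

/-- **Hypothesis `FreyHeckeBoundaryDepth` — the Frey vector is a Hecke boundary to depth `v₂(q−1) − c` (research
statement, NOT proved, NOT in print; k3's kernel K_B).**  There is `c` such that at every forced pair `(q, ℓ)`, in every
Brandt setup `S` of type `(N/ℓ, ℓ)` and for every generator `φ` of the `a(E)`-eigen-line, `E = E_(−ℓ,ℓ−1)`: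
`φ = Σ_{p ∈ s} (B(p) y_p − a_p(E) y_p) + 2^{v₂(q−1)−c} z` for some finite set `s` of primes `p ∤ N`, integer vectors
`y_p`, `z` — i.e. `φ ∈ I_E ℤ[Cls O] + 2^{v₂(q−1)−c} ℤ[Cls O]` for the Eisenstein-shifted Hecke ideal
`I_E = (B(p) − a_p(E) : p ∤ N)`.  STRICTLY STRONGER than the registered stub (`forcedPairOccurrence_of_freyHeckeBoundaryDepth`):
the gap is the 2-torsion of the coinvariant module `ℤ[Cls O] / I_E ℤ[Cls O]` at the Eisenstein maximal ideal `(2, I_E)`.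
HYPOTHESIS; not a Literature fact. -/
def FreyHeckeBoundaryDepth : Prop :=
  ∃ c : ℕ, ∀ q ℓ : ℕ, q.Prime → ℓ.Prime → q ≠ 2 → 32 * q ∣ ℓ - 1 →
    ∀ N : ℕ, (freyCurve (-(ℓ : ℤ)) ((ℓ - 1 : ℕ) : ℤ)).conductorNorm ℤ = N →
    ∀ (S : Brandt.XiSetup (N / ℓ) ℓ) [Fintype (Brandt.ClassSet S.O)],
      ∀ φ : Brandt.ClassSet S.O → ℤ, φ ≠ 0 →
        Brandt.eigenLattice (N / ℓ * ℓ) (Brandt.matrix S.O)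
            (fun n => (freyCurve (-(ℓ : ℤ)) ((ℓ - 1 : ℕ) : ℤ)).LFunction n) = ℤ ∙ φ →
        ∃ (s : Finset ℕ) (y : ℕ → Brandt.ClassSet S.O → ℤ) (z : Brandt.ClassSet S.O → ℤ),
          (∀ p ∈ s, p.Prime ∧ ¬ p ∣ N / ℓ * ℓ) ∧
          φ = ∑ p ∈ s, (Brandt.matrix S.O p *ᵥ y p
                  - (freyCurve (-(ℓ : ℤ)) ((ℓ - 1 : ℕ) : ℤ)).LFunction p • y p)
                + (((2 ^ ((q - 1).factorization 2 - c) : ℕ) : ℤ)) • z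

/-- **`FreyHeckeBoundaryDepth → ForcedPairOccurrence`** (the registered stub `stub_forcedPairOccurrence`, by its
Theorems-side name; k3 B-H5; same `c`): `occurrence_of_heckeBoundary` with `T := Brandt.matrix S.O`, Eichler's weight
symmetry `Brandt.XiSetup.weight_mul_matrix_symm` (proved in the tree) and `φ ∈ ℤ ∙ φ = eigenLattice`
(`Brandt.mem_eigenLattice_iff`) for the eigenvector property at the primes of `s`. [cite: Eichler1973, Ch. II §6 (17)] -/
theorem forcedPairOccurrence_of_freyHeckeBoundaryDepth (h : FreyHeckeBoundaryDepth) : ForcedPairOccurrence := by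
  obtain ⟨c, hc⟩ := h
  refine ⟨c, fun q ℓ hq hℓ hq2 h32 N hN S _ φ hφ hL => ?_⟩
  obtain ⟨s, y, z, hs, hφs⟩ := hc q ℓ hq hℓ hq2 h32 N hN S φ hφ hL
  have hmem : φ ∈ Brandt.eigenLattice (N / ℓ * ℓ) (Brandt.matrix S.O)
      (fun n => (freyCurve (-(ℓ : ℤ)) ((ℓ - 1 : ℕ) : ℤ)).LFunction n) := by
    rw [hL]; exact Submodule.mem_span_singleton_self φ
  exact occurrence_of_heckeBoundary (Brandt.weight S.O) (fun p => Brandt.matrix S.O p)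
    (fun p => (freyCurve (-(ℓ : ℤ)) ((ℓ - 1 : ℕ) : ℤ)).LFunction p) s
    (fun p _ i j => S.weight_mul_matrix_symm p i j)
    (fun p hp => Brandt.mem_eigenLattice_iff.mp hmem p (hs p hp).1 (hs p hp).2) _ y z hφs

end Summit.ABC.ABC.Theorems

end
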